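import Literature.NumberTheory.ComplexMultiplication.CMOrderConductorDifferentFormula
import Literature.NumberTheory.ComplexMultiplication.CMOrderDiscriminant
import Mathlib.NumberTheory.NumberField.Discriminant.Different
import HarnessLib

/-!
# The norm of the conductor of a monogenic order: `N(𝔣_{ℤ[α]}) = [𝓞_K : ℤ[α]]²`

Layer A3 of the Hodge/CM programme (docs/m5/MAPPING.md §1), the "arbitrary order" series (`𝔯 = endOrder ρ`, conductor
`𝔣 = EndOrder.conductor ρ ⊆ 𝓞_K`, index `[𝓞_K : 𝔯] = (toRingOfIntegers ρ).range.toAddSubgroup.index`).  For a MONOGENIC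
order `𝔯 = ℤ[α]` three classical identities combine:

* `𝔣 · 𝔇_{K/ℚ} = (f′(α))` (`CMOrderConductorDifferentFormula`) and `N(𝔇_{K/ℚ}) = |Δ_K|` (Mathlib
  `NumberField.absNorm_differentIdeal`) give **`absNorm_conductor_mul_natAbs_discr_eq`**: `N(𝔣) · |Δ_K| = |N_{K/ℚ}(f′(α))|`
  [NeukirchANT1999, III (2.4), (2.9)];
* `Δ(ℤ[α]) = ±N_{K/ℚ}(f′(α))` (the discriminant of the power basis, Mathlib `Algebra.discr_powerBasis_eq_norm`) and the
  index formula `Δ(𝔯) = [𝓞_K : 𝔯]² · Δ_K` (`CMOrderDiscriminant`, Stevenhagen (7-3)/(7-7)) give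
  **`natAbs_norm_aeval_derivative_eq_index_sq_mul`**: `|N_{K/ℚ}(f′(α))| = [𝓞_K : ℤ[α]]² · |Δ_K|`
  [Stevenhagen2008NumberRings, (7-7) «`Δ(f) = [𝒪_K : ℤ[α]]² · Δ_K`»];
* with `N(𝔣) = [𝓞_K : 𝔯]·[𝔯 : 𝔣]` (`absNorm_conductor_eq_index_mul_relIndex`, ANY order; `index_dvd_absNorm_conductor`)
  hence **`absNorm_conductor_eq_index_sq`**: `N(𝔣_{ℤ[α]}) = [𝓞_K : ℤ[α]]²` and **`relIndex_conductor_eq_index`**: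
  `[ℤ[α] : 𝔣] = [𝓞_K : ℤ[α]]`; validation
  `EisensteinTwo.absNorm_conductor_basis_eq_four` (`ℤ[√-3] = ℤ[2ζ₃]`: `N(𝔣) = 2² = 4`, indeed `𝔣 = 2𝓞_K`).

Theorems only (no new definitions, no named facts).

## References
* [Stevenhagen2008NumberRings] P. Stevenhagen, *The arithmetic of number rings*, MSRI Publ. 44 (2008) — §7 (7-3),
  (7-7) («`Δ(f) = [𝒪_K : ℤ[α]]² · Δ_K`»), pp. 228–229; §6 (conductor), p. 224.
* [NeukirchANT1999] J. Neukirch, *Algebraic Number Theory*, Springer 1999 — Ch. III §2 (2.4) («`𝔇 = (f′(α))` for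
  `𝒪 = o[α]`») and the remark after it, pp. 197–198; (2.9) («`N(𝔇_{L|K}) = 𝔡_{L|K}`»), p. 201.
-/

noncomputable section

open scoped Classical nonZeroDivisors NumberField
open NumberField Module Polynomial

namespace Literature.NumberTheory.ComplexMultiplication

namespace EndOrder

section ConductorNorm

variable {K : Type} [Field K] [NumberField K]
variable {ι : Type} [Fintype ι] [DecidableEq ι] [Nonempty ι] {ρ : K →ₐ[ℚ] Matrix ι ι ℚ}

/-- **`N(𝔣) · |Δ_K| = |N_{K/ℚ}(f′(α))|` for `𝔯 = ℤ[α]`** (norms of `𝔣 · 𝔇 = (f′(α))`, with `N(𝔇) = |Δ_K|`).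
[cite: NeukirchANT1999, Ch. III §2 Prop. (2.4) and Thm. (2.9), pp. 197–201] -/
theorem absNorm_conductor_mul_natAbs_discr_eq {x : 𝓞 K}
    (h : endOrder ρ = (Algebra.adjoin ℤ ({(x : K)} : Set K)).toSubring) (hx : Algebra.adjoin ℚ ({(x : K)} : Set K) = ⊤) :
    Ideal.absNorm (EndOrder.conductor ρ) * (NumberField.discr K).natAbs =
      (Algebra.norm ℤ (aeval x (derivative (minpoly ℤ x)))).natAbs := by
  have h1 := congrArg Ideal.absNorm (EndOrder.conductor_mul_differentIdeal_eq_span_aeval_derivative h hx)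
  rwa [map_mul, NumberField.absNorm_differentIdeal (K := K), Ideal.absNorm_span_singleton] at h1

/-- **`|Δ(f)| = |N_{K/ℚ}(f′(α))| = [𝓞_K : ℤ[α]]² · |Δ_K|` for `𝔯 = ℤ[α]`** — the discriminant of the power basis
`1, α, …, α^{n-1}` of `𝔯` is `±N(f′(α))`, and `Δ(𝔯) = [𝓞_K : 𝔯]² Δ_K`. [cite: Stevenhagen2008NumberRings, §7 (7-7)
(«`Δ(f) = [𝒪_K : ℤ[α]]² · Δ_K`»), p. 229] -/
theorem natAbs_norm_aeval_derivative_eq_index_sq_mul {x : 𝓞 K}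
    (h : endOrder ρ = (Algebra.adjoin ℤ ({(x : K)} : Set K)).toSubring) (hx : Algebra.adjoin ℚ ({(x : K)} : Set K) = ⊤) :
    (Algebra.norm ℤ (aeval x (derivative (minpoly ℤ x)))).natAbs =
      (toRingOfIntegers ρ).range.toAddSubgroup.index ^ 2 * (NumberField.discr K).natAbs := by
  set α : K := (x : K) with hα
  have hint : IsIntegral ℤ α := RingOfIntegers.isIntegral_coe x
  have hintℚ : IsIntegral ℚ α := hint.tower_top
  -- the power basis of `ℤ[α]`, transported to `𝔯`
  let pbZ := Algebra.adjoin.powerBasis' hint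
  let e : (Algebra.adjoin ℤ ({α} : Set K)) ≃+ endOrder ρ :=
    { toFun := fun y => ⟨(y : K), h.symm.le (Subalgebra.mem_toSubring.2 y.2)⟩
      invFun := fun z => ⟨(z : K), Subalgebra.mem_toSubring.1 (h.le z.2)⟩
      left_inv := fun _ => rfl
      right_inv := fun _ => rfl
      map_add' := fun _ _ => rfl }
  let b : Basis (Fin pbZ.dim) ℤ (endOrder ρ) := pbZ.basis.map e.toIntLinearEquiv
  have hb : ∀ i, ((b i : endOrder ρ) : K) = α ^ (i : ℕ) := fun i => by
    change ((((Algebra.adjoin.powerBasis' hint).basis i : Algebra.adjoin ℤ ({α} : Set K))) : K) = α ^ (i : ℕ)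
    rw [PowerBasis.coe_basis]
    dsimp only
    rw [SubmonoidClass.coe_pow, Algebra.adjoin.powerBasis'_gen]
  -- `Δ(𝔯) = [𝓞_K : 𝔯]² Δ_K` for this basis
  have hidx := natAbs_discr_eq (ρ := ρ) b
  -- `Δ(b) = Δ_ℚ(1, α, …, α^{n-1}) = ± N(f′(α))`
  let pbK : PowerBasis ℚ K := PowerBasis.ofAdjoinEqTop hintℚ hx
  have hdim : pbZ.dim = pbK.dim := by
    change (minpoly ℤ α).natDegree = (minpoly ℚ α).natDegree
    rw [minpoly.isIntegrallyClosed_eq_field_fractions' ℚ hint, natDegree_map_eq_of_injective Int.cast_injective]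
  have hfam : (fun i : Fin pbZ.dim => ((b i : endOrder ρ) : K)) = pbK.basis ∘ ⇑(finCongr hdim.symm).symm := by
    funext i
    rw [hb, Function.comp_apply, PowerBasis.coe_basis, PowerBasis.ofAdjoinEqTop_gen]
    simp
  have hdisc : (Algebra.discr ℤ b : ℚ) =
      (-1) ^ (finrank ℚ K * (finrank ℚ K - 1) / 2) * Algebra.norm ℚ (aeval α (derivative (minpoly ℚ α))) := by
    rw [algebraMap_discr_eq b, hfam, Algebra.discr_reindex, Algebra.discr_powerBasis_eq_norm,
      PowerBasis.ofAdjoinEqTop_gen]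
  -- `N_ℚ(f′(α)) = N_ℤ(f′(x))`
  have hmin : minpoly ℤ α = minpoly ℤ x := by
    rw [hα, RingOfIntegers.coe_eq_algebraMap]
    exact minpoly.algebraMap_eq (IsFractionRing.injective (𝓞 K) K) x
  have haev : (((aeval x (derivative (minpoly ℤ x)) : 𝓞 K)) : K) = aeval α (derivative (minpoly ℤ x)) := by
    simp only [hα, RingOfIntegers.coe_eq_algebraMap]
    exact (aeval_algebraMap_apply K x (derivative (minpoly ℤ x))).symm
  have hnorm : Algebra.norm ℚ (aeval α (derivative (minpoly ℚ α))) =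
      (Algebra.norm ℤ (aeval x (derivative (minpoly ℤ x))) : ℚ) := by
    rw [Algebra.coe_norm_int, minpoly.isIntegrallyClosed_eq_field_fractions' ℚ hint, derivative_map,
      aeval_map_algebraMap, hmin, haev]
  rw [hnorm] at hdisc
  have hZ : Algebra.discr ℤ b = (-1) ^ (finrank ℚ K * (finrank ℚ K - 1) / 2) *
      Algebra.norm ℤ (aeval x (derivative (minpoly ℤ x))) := by exact_mod_cast hdisc
  rw [← hidx, hZ, Int.natAbs_mul, Int.natAbs_pow, Int.natAbs_neg, Int.natAbs_one, one_pow, one_mul]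

/-- `𝔣 ⊆ 𝔯` inside `𝓞_K` (as additive subgroups: `𝔣 ⊆ 𝔯`, `CMOrderConductor.coe_mem_endOrder_of_mem_conductor`).
[cite: Stevenhagen2008NumberRings, §6 («the conductor … is the largest `𝒪`-ideal contained in `R`»), p. 224] -/
theorem conductor_toAddSubgroup_le_range :
    (EndOrder.conductor ρ).toAddSubgroup ≤ (toRingOfIntegers ρ).range.toAddSubgroup := fun x hx =>
  Subring.mem_toAddSubgroup.2 ⟨⟨(x : K), coe_mem_endOrder_of_mem_conductor ρ hx⟩, toRingOfIntegers_mk ρ _⟩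

/-- **`N(𝔣) = [𝓞_K : 𝔯] · [𝔯 : 𝔣]` for EVERY order `𝔯`** (`𝔣 ⊆ 𝔯 ⊆ 𝓞_K`, indices of additive groups).
[cite: Stevenhagen2008NumberRings, §6, p. 224] -/
theorem absNorm_conductor_eq_index_mul_relIndex :
    Ideal.absNorm (EndOrder.conductor ρ) =
      (toRingOfIntegers ρ).range.toAddSubgroup.index *
        (EndOrder.conductor ρ).toAddSubgroup.relIndex (toRingOfIntegers ρ).range.toAddSubgroup := by
  rw [mul_comm, AddSubgroup.relIndex_mul_index (conductor_toAddSubgroup_le_range (ρ := ρ))]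
  rfl

/-- **`[𝓞_K : 𝔯] ∣ N(𝔣)`** for every order `𝔯`. [cite: Stevenhagen2008NumberRings, §6, p. 224] -/
theorem index_dvd_absNorm_conductor :
    (toRingOfIntegers ρ).range.toAddSubgroup.index ∣ Ideal.absNorm (EndOrder.conductor ρ) :=
  Dvd.intro _ (absNorm_conductor_eq_index_mul_relIndex (ρ := ρ)).symm

/-- **`N(𝔣_{ℤ[α]}) = [𝓞_K : ℤ[α]]²`: the norm of the conductor of a monogenic order is the square of its index.**
[cite: Stevenhagen2008NumberRings, §7 (7-7), p. 229; §6, p. 224] [cite: NeukirchANT1999, Ch. III §2 (2.4), (2.9), pp. 197–201] -/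
theorem absNorm_conductor_eq_index_sq {x : 𝓞 K}
    (h : endOrder ρ = (Algebra.adjoin ℤ ({(x : K)} : Set K)).toSubring) (hx : Algebra.adjoin ℚ ({(x : K)} : Set K) = ⊤) :
    Ideal.absNorm (EndOrder.conductor ρ) = (toRingOfIntegers ρ).range.toAddSubgroup.index ^ 2 := by
  have h1 := absNorm_conductor_mul_natAbs_discr_eq h hx
  rw [natAbs_norm_aeval_derivative_eq_index_sq_mul h hx] at h1
  exact Nat.eq_of_mul_eq_mul_right (Int.natAbs_pos.2 (NumberField.discr_ne_zero K)) h1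

/-- **`[ℤ[α] : 𝔣] = [𝓞_K : ℤ[α]]` for a monogenic order** («`#(R/𝔣) = #(𝒪_K/R)`»; e.g. `R = ℤ[√-3]`: both are `2`):
from `N(𝔣) = [𝓞_K : 𝔯]·[𝔯 : 𝔣]` and `N(𝔣) = [𝓞_K : 𝔯]²`. [cite: Stevenhagen2008NumberRings, §7 (7-7), p. 229, and
Example 6.9 («the order `R = ℤ[√-3]` of index 2 in `𝒪 = ℤ[ω]` … `𝔣_R = 2𝒪`»), p. 226] -/
theorem relIndex_conductor_eq_index {x : 𝓞 K}
    (h : endOrder ρ = (Algebra.adjoin ℤ ({(x : K)} : Set K)).toSubring) (hx : Algebra.adjoin ℚ ({(x : K)} : Set K) = ⊤) :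
    (EndOrder.conductor ρ).toAddSubgroup.relIndex (toRingOfIntegers ρ).range.toAddSubgroup =
      (toRingOfIntegers ρ).range.toAddSubgroup.index := by
  have hsq := absNorm_conductor_eq_index_sq h hx
  have h0 : (toRingOfIntegers ρ).range.toAddSubgroup.index ≠ 0 := fun h0 =>
    conductor_ne_bot ρ (Ideal.absNorm_eq_zero_iff.1 (by rw [hsq, h0, zero_pow two_ne_zero]))
  have h1 := absNorm_conductor_eq_index_mul_relIndex (ρ := ρ)
  rw [hsq, sq] at h1
  exact (Nat.eq_of_mul_eq_mul_left (Nat.pos_of_ne_zero h0) h1).symm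

end ConductorNorm

end EndOrder

/-! ## Validation on `𝔯 = ℤ[√-3] = ℤ[2ζ₃] ⊂ ℤ[ζ₃]`: `N(𝔣) = 2² = 4` (indeed `𝔣 = 2𝓞_K`) -/

namespace CMTypeLattice

namespace EisensteinTwo

/-- `ℚ(2ζ₃) = ℚ(ζ₃)`: `2ζ₃` generates `K₃` over `ℚ`. [cite: Cox2013, §7.A Lemma 7.2 (the basis `(1, f w_K)`), p. 133] -/
theorem adjoin_twoMulZeta_eq_top : Algebra.adjoin ℚ ({2 * zeta} : Set K₃) = ⊤ := by
  have hζ : IsPrimitiveRoot zeta 3 := IsCyclotomicExtension.zeta_spec 3 ℚ K₃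
  refine top_le_iff.1 ?_
  rw [← IsCyclotomicExtension.adjoin_primitive_root_eq_top hζ]
  refine Algebra.adjoin_le (Set.singleton_subset_iff.2 ?_)
  have h : zeta = (2 : ℚ)⁻¹ • (2 * zeta) := by
    rw [Algebra.smul_def, map_inv₀, map_ofNat, ← mul_assoc, inv_mul_cancel₀ (two_ne_zero' K₃), one_mul]
  have hmem : (2 : ℚ)⁻¹ • (2 * zeta) ∈ Algebra.adjoin ℚ ({2 * zeta} : Set K₃) :=
    Subalgebra.smul_mem (Algebra.adjoin ℚ ({2 * zeta} : Set K₃)) (Algebra.self_mem_adjoin_singleton ℚ (2 * zeta)) _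
  rw [← h] at hmem
  exact hmem

/-- **`N(𝔣) = [ℤ[ζ₃] : ℤ[√-3]]² = 4` for the order `ℤ[√-3] = ℤ[2ζ₃]`** — the general formula
`EndOrder.absNorm_conductor_eq_index_sq` at the running example (`𝔣 = 2𝓞_K`, `CMOrderConductor.conductor_basis_eq_span_two`,
`N(2𝓞_K) = 4`, `CMOrderPicardToClassGroup.absNorm_span_two`). [cite: Stevenhagen2008NumberRings, Example 6.9 («the order
`R = ℤ[√-3]` of index 2 in `𝒪 = ℤ[ω]` … `𝔣_R = 2𝒪`»), p. 226] -/
theorem absNorm_conductor_basis_eq_four :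
    Ideal.absNorm (EndOrder.conductor (Algebra.leftMulMatrix basis)) = 4 := by
  rw [EndOrder.absNorm_conductor_eq_index_sq (x := ⟨2 * zeta, isIntegral_twoMulZeta⟩) endOrder_basis_eq_adjoin
    adjoin_twoMulZeta_eq_top, index_range_toRingOfIntegers_eq_two]
  norm_num

end EisensteinTwo

end CMTypeLattice

end Literature.NumberTheory.ComplexMultiplication
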